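import Mathlib
import Summits.SmoothPoincare4.SmoothPoincare4.Theses.CylinderEntropy
import Summits.SmoothPoincare4.SmoothPoincare4.Theses.EntropyLadder
import Summits.SmoothPoincare4.SmoothPoincare4.Theses.Stabilisation
import Summits.SmoothPoincare4.SmoothPoincare4.Theorems.CylinderEntropySliceCalibration
import Literature.Geometry.Riemannian.SphericalCylinderEntropy
import Literature.Geometry.Manifold.CylinderSlice
import Literature.Topology.FourManifolds.CerfGammaFourProofs
import Literature.Topology.FourManifolds.HomotopyS4CompactProofs
import Literature.Topology.FourManifolds.HomotopyS4OrientableProofs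

/-!
# STRATEGY CENSUS — typed companion (crux E = `CylinderEntropy.ThinCrossSectionExists`, stmt-SmoothPoincare4-7633)

**NOT A LINE.** No `stub_*`, no `ThinCrossSectionExists_of`, nothing registered.  Crux-strategist (wall-breaker, gen 1)
artefact accompanying `STRATEGY-CENSUS.md`: the STRENGTHEN and DECOMPOSITION attempts of the census, typed over tree
declarations and kernel-checked, so that the census's negative conclusions are statements about named Props and proved
implications rather than prose.

What is proved here (all sorry-free):

* §0 `crossSectionBelow_of_diffeomorph` — pointwise slice lemma `M ≅ S⁴ ⇒ M has a thin cross-section` (landed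
  calibration `cylEntropy_slice₀_le_one`); `crux_iff` (`Iff.rfl` against the item).
* §1 SPLIT A (EntropyLadder shape).  `ThinForPresentation` (T′ := E restricted to homotopy spheres bounding a contractible
  5-dimensional 2-handlebody, EntropyLadder's `Bounds₂` clause verbatim) with the glue
  `crux_of_splitA : EntropyLadder.BoundsContractibleTwoHandlebody → ThinForPresentation → E` PROVED, and the COSTUME
  CERTIFICATE: `presentationSpheresStandard_of_splitA : CylinderRungTwo → ThinForPresentation → EntropyLadder.PresentationSpheresStandard`
  and `thinForPresentation_of_standard : EntropyLadder.PresentationSpheresStandard → ThinForPresentation` — so modulo the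
  route's own rank-2 crux R the residual piece T′ IS EntropyLadder's rank-2 crux T, and split A is EntropyLadder's `closes`
  wearing this crux's badge.
* §2 SPLIT B (Stabilisation shape).  `ThinForOneStab` (E₁ := E restricted to 1-stably-standard homotopy spheres, route
  Stabilisation's `OneStab` clause verbatim) with the glue `crux_of_splitB : Stabilisation.StabOneSuffices → ThinForOneStab → E`
  PROVED (packaging `M` as a `HomotopySphere 4` exactly as `Stabilisation.closes` does), and the COSTUME CERTIFICATE
  `stabCancellation_of_splitB : CylinderRungTwo → ThinForOneStab → Stabilisation.StabCancellation`,
  `thinForOneStab_of_stabCancellation : Stabilisation.StabCancellation → ThinForOneStab` — modulo R the residual piece E₁ IS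
  Stabilisation's rank-2 crux S2.
* §3 STRENGTHEN (closed threshold).  `EClosed` (`≤ 4/e`), `RClosed` (R at the closed threshold) and
  `crux_of_closed : EClosed → RClosed → E` PROVED — its proof term ends in `crossSectionBelow_of_diffeomorph` (witness =
  slice∘φ, the round-1 costume fingerprint, exhibited deliberately), `cylinderRungTwo_of_rClosed : RClosed → CylinderRungTwo`
  (the gap piece CONTAINS the sibling crux R) and `eClosed_of_crux : E → EClosed`.
* §4 STRENGTHEN (isotopy form).  `CrossSectionEmbeddingExists` (SPC4-free: Θ₄ʰ = 0 + Smale n = 5), `EIso` (every cross-section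
  embedding of a homotopy 4-sphere is isotopic THROUGH smooth cross-sections to a thin one) and
  `crux_of_iso : CrossSectionEmbeddingExists → EIso → E` PROVED; `EIso` is stronger than E and (census §Strengthen) true at
  `M = S⁴`, with no mechanism off `S⁴`.

Nothing here is new mathematics; the point is that each census entry names a checked Prop and a checked implication.
-/

noncomputable section

open scoped BigOperators Topology Manifold MeasureTheory ENNReal NNReal ContDiff ContinuousMap
open Set Function MeasureTheory
open Literature.Geometry.Riemannian.SphericalCylinderEntropy (cylEntropy cylDensity cylKernel)
open Literature.Geometry.Manifold.CylinderSlice (sliceMap range_sliceMap isSmoothEmbedding_sliceMap sum_sq_sliceMap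
  separatesEnds_of_slice_subset)

set_option linter.dupNamespace false

namespace Summit.SmoothPoincare4.SmoothPoincare4.Cruxes.ThinCrossSectionExists.StrategyCensus

open Summit.SmoothPoincare4.SmoothPoincare4.Theses.CylinderEntropy (ThinCrossSectionExists CylinderRungTwo)
open Summit.SmoothPoincare4.SmoothPoincare4.Theses

local notation "E⁶" => EuclideanSpace ℝ (Fin 6)
local notation "E⁴" => EuclideanSpace ℝ (Fin 4)
local notation "𝕊⁴" => (Metric.sphere (0 : EuclideanSpace ℝ (Fin 5)) 1)
local notation "𝕊²" => (Metric.sphere (0 : EuclideanSpace ℝ (Fin 3)) 1)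

/-! ## §0 Vocabulary (verbatim sub-expressions of the item) and the pointwise slice lemma -/

/-- `z ∈ N = S⁴×ℝ ⊂ ℝ⁶`, literally as in the items. -/
def InN (z : E⁶) : Prop := ∑ i : Fin 5, z (Fin.castSucc i) ^ 2 = 1

/-- "separates the two ends of `N`", literally as in the items. -/
def Separates (A : Set E⁶) : Prop :=
  ∃ R : ℝ, ∀ a b : E⁶, InN a → InN b → a 5 ≤ -R → R ≤ b 5 → ¬ JoinedIn ({z : E⁶ | InN z} \ A) a b

/-- The bubble-sheet threshold `4/e` as typed. -/
def level : ℝ≥0∞ := ENNReal.ofReal (4 / Real.exp 1)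

/-- `M` has an end-separating smooth cross-section embedding of typed cylinder entropy `< c`. -/
def CrossSectionBelow (c : ℝ≥0∞) (M : Type) [TopologicalSpace M] [ChartedSpace E⁴ M] : Prop :=
  ∃ ι : M → E⁶, Manifold.IsSmoothEmbedding (𝓡 4) (𝓡 6) ∞ ι ∧ (∀ x, InN (ι x)) ∧
    Separates (Set.range ι) ∧ cylEntropy (Set.range ι) < c

/-- Same, closed threshold. -/
def CrossSectionLe (c : ℝ≥0∞) (M : Type) [TopologicalSpace M] [ChartedSpace E⁴ M] : Prop :=
  ∃ ι : M → E⁶, Manifold.IsSmoothEmbedding (𝓡 4) (𝓡 6) ∞ ι ∧ (∀ x, InN (ι x)) ∧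
    Separates (Set.range ι) ∧ cylEntropy (Set.range ι) ≤ c

/-- The crux E is literally "every homotopy 4-sphere of the bare frame is `CrossSectionBelow (4/e)`". -/
theorem crux_iff : ThinCrossSectionExists ↔
    ∀ (M : Type) [TopologicalSpace M] [T2Space M] [SecondCountableTopology M]
      [ChartedSpace E⁴ M] [IsManifold (𝓡 4) ∞ M], M ≃ₕ 𝕊⁴ → CrossSectionBelow level M := Iff.rfl

/-- `1 < 4/e`. -/
lemma one_lt_level : (1 : ℝ≥0∞) < level := by
  rw [level, ← ENNReal.ofReal_one]
  refine (ENNReal.ofReal_lt_ofReal_iff (by positivity)).mpr ?_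
  rw [lt_div_iff₀ (Real.exp_pos 1)]
  have := Real.exp_one_lt_d9
  linarith

/-- **Pointwise slice lemma**: a manifold diffeomorphic to `S⁴` has a thin cross-section — the slice transported along the
diffeomorphism (landed `cylEntropy_slice₀_le_one`, tree `isSmoothEmbedding_sliceMap`, `comp_diffeomorph`).  This is the
per-manifold form of the landed `crux_of_smoothPoincare4 : SPC4 → E`; every "costume" below ends in it. -/
theorem crossSectionBelow_of_diffeomorph {M : Type} [TopologicalSpace M] [ChartedSpace E⁴ M] [IsManifold (𝓡 4) ∞ M]
    (φ : M ≃ₘ⟮𝓡 4, 𝓡 4⟯ 𝕊⁴) : CrossSectionBelow level M := by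
  have hr : Set.range (sliceMap 0 ∘ φ) = Set.range (sliceMap 0) := by
    ext z
    simp only [Set.mem_range, Function.comp_apply]
    constructor
    · rintro ⟨x, rfl⟩; exact ⟨φ x, rfl⟩
    · rintro ⟨y, rfl⟩; exact ⟨φ.symm y, by simp⟩
  refine ⟨sliceMap 0 ∘ φ, (isSmoothEmbedding_sliceMap 0).comp_diffeomorph φ, fun x => sum_sq_sliceMap 0 (φ x), ?_, ?_⟩
  · rw [hr, range_sliceMap]
    exact separatesEnds_of_slice_subset subset_rfl
  · rw [hr, range_sliceMap]
    exact lt_of_le_of_lt Summit.SmoothPoincare4.SmoothPoincare4.Theorems.cylEntropy_slice₀_le_one one_lt_level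

/-! ## §1 SPLIT A — EntropyLadder shape: `E ⇐ B ∧ T′`

`B` = `EntropyLadder.BoundsContractibleTwoHandlebody` (stmt-SmoothPoincare4-3720: every homotopy 4-sphere bounds a compact
contractible 5-manifold with an adapted Morse function of index ≤ 2); `T′` = E restricted to such spheres. -/

/-- EntropyLadder's `Bounds₂` clause, verbatim. -/
def Bounds₂ (M : Type) [TopologicalSpace M] [ChartedSpace E⁴ M] : Prop :=
  ∃ (W : Type) (_ : TopologicalSpace W) (_ : T2Space W) (_ : SecondCountableTopology W)
    (_ : ChartedSpace (EuclideanHalfSpace (4 + 1)) W) (_ : IsManifold (𝓡∂ (4 + 1)) ∞ W) (_ : CompactSpace W),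
    ContractibleSpace W ∧
      (∃ f : W → ℝ, Literature.Topology.FourManifolds.IsMorseAdapted (𝓡∂ (4 + 1)) f ∧
        ∀ z, Literature.Topology.FourManifolds.IsMCriticalPt (𝓡∂ (4 + 1)) f z →
          Literature.Topology.FourManifolds.morseIndex (𝓡∂ (4 + 1)) f z ≤ 2) ∧
      ∃ φ : M → W, Manifold.IsSmoothEmbedding (𝓡 4) (𝓡∂ (4 + 1)) ∞ φ ∧ Set.range φ = (𝓡∂ (4 + 1)).boundary W

/-- Certificate that the copy is verbatim: B ↔ "every homotopy 4-sphere is `Bounds₂`". -/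
theorem boundsContractibleTwoHandlebody_iff : EntropyLadder.BoundsContractibleTwoHandlebody ↔
    ∀ (M : Type) [TopologicalSpace M] [T2Space M] [SecondCountableTopology M]
      [ChartedSpace E⁴ M] [IsManifold (𝓡 4) ∞ M], M ≃ₕ 𝕊⁴ → Bounds₂ M := Iff.rfl

/-- Certificate: T ↔ "every `Bounds₂` homotopy 4-sphere is standard". -/
theorem presentationSpheresStandard_iff : EntropyLadder.PresentationSpheresStandard ↔
    ∀ (M : Type) [TopologicalSpace M] [T2Space M] [SecondCountableTopology M]
      [ChartedSpace E⁴ M] [IsManifold (𝓡 4) ∞ M], M ≃ₕ 𝕊⁴ → Bounds₂ M → Nonempty (M ≃ₘ⟮𝓡 4, 𝓡 4⟯ 𝕊⁴) := Iff.rfl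

/-- **T′** — thin cross-sections for presentation spheres (E with the extra hypothesis `Bounds₂ M`). -/
def ThinForPresentation : Prop :=
  ∀ (M : Type) [TopologicalSpace M] [T2Space M] [SecondCountableTopology M]
    [ChartedSpace E⁴ M] [IsManifold (𝓡 4) ∞ M], M ≃ₕ 𝕊⁴ → Bounds₂ M → CrossSectionBelow level M

/-- **Glue of split A** (trivial logic): `B → T′ → E`. -/
theorem crux_of_splitA (hB : EntropyLadder.BoundsContractibleTwoHandlebody) (hT : ThinForPresentation) :
    ThinCrossSectionExists := by
  rw [crux_iff]
  intro M _ _ _ _ _ e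
  exact hT M e ((boundsContractibleTwoHandlebody_iff.mp hB) M e)

/-- **Costume certificate, direction 1**: modulo the route's OWN rank-2 crux R, the residual piece T′ implies EntropyLadder's
rank-2 crux T (thin ⇒ standard by R). -/
theorem presentationSpheresStandard_of_splitA (hR : CylinderRungTwo) (hT : ThinForPresentation) :
    EntropyLadder.PresentationSpheresStandard := by
  rw [presentationSpheresStandard_iff]
  intro M _ _ _ _ _ e hW
  obtain ⟨ι, h1, h2, ⟨R, h3⟩, h4⟩ := hT M e hW
  exact hR M e ι h1 h2 ⟨R, h3⟩ h4

/-- **Costume certificate, direction 2**: T implies T′ outright (slice through the diffeomorphism).  So T′ ⟺ T modulo R: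
split A decomposes the SUMMIT (`B ∧ T ⟺ SPC4`, EntropyLadder's factorisation), not the crux. -/
theorem thinForPresentation_of_standard (hT : EntropyLadder.PresentationSpheresStandard) : ThinForPresentation := by
  intro M _ _ _ _ _ e hW
  obtain ⟨φ⟩ := (presentationSpheresStandard_iff.mp hT) M e hW
  exact crossSectionBelow_of_diffeomorph φ

/-! ## §2 SPLIT B — Stabilisation shape: `E ⇐ S1 ∧ E₁`

`S1` = `Stabilisation.StabOneSuffices` (stmt-SmoothPoincare4-0386: `Σ # (S²×S²) ≅ S²×S²` for every homotopy 4-sphere);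
`E₁` = E restricted to such spheres. -/

/-- Route Stabilisation's `OneStab` clause, verbatim. -/
def OneStab (S : Literature.Topology.FourManifolds.HomotopySphere 4) : Prop :=
  ∃ (P : Type) (_ : TopologicalSpace P) (_ : ChartedSpace (EuclideanSpace ℝ (Fin 4)) P) (_ : IsManifold (𝓡 4) ∞ P),
    Literature.Topology.FourManifolds.IsConnectedSum (𝓡 4) (𝓡 4) ((𝓡 2).prod (𝓡 2)) S.carrier (𝕊² × 𝕊²) P ∧
      Nonempty (P ≃ₘ⟮𝓡 4, (𝓡 2).prod (𝓡 2)⟯ (𝕊² × 𝕊²))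

/-- Certificate: S1 ↔ "every homotopy 4-sphere is `OneStab`". -/
theorem stabOneSuffices_iff : Stabilisation.StabOneSuffices ↔
    ∀ S : Literature.Topology.FourManifolds.HomotopySphere 4, OneStab S := Iff.rfl

/-- Certificate: S2 ↔ "every `OneStab` homotopy 4-sphere is standard". -/
theorem stabCancellation_iff : Stabilisation.StabCancellation ↔
    ∀ S : Literature.Topology.FourManifolds.HomotopySphere 4, OneStab S →
      Nonempty (S.carrier ≃ₘ⟮𝓡 4, 𝓡 4⟯ 𝕊⁴) := Iff.rfl

/-- **E₁** — thin cross-sections for 1-stably-standard homotopy spheres. -/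
def ThinForOneStab : Prop :=
  ∀ S : Literature.Topology.FourManifolds.HomotopySphere 4, OneStab S → CrossSectionBelow level S.carrier

/-- **Glue of split B**: `S1 → E₁ → E` (packaging the bare frame as a `HomotopySphere 4` — compact by `H₄`, orientable by
simple connectivity — exactly as `Stabilisation.closes` does). -/
theorem crux_of_splitB (h1 : Stabilisation.StabOneSuffices) (h2 : ThinForOneStab) : ThinCrossSectionExists := by
  rw [crux_iff]
  intro M _ _ _ _ _ e
  haveI : CompactSpace M :=
    Literature.Topology.FourManifolds.compactSpace_of_homotopyEquiv_sphere_four_holds M e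
  let S : Literature.Topology.FourManifolds.HomotopySphere 4 :=
    { carrier := M
      orientation := Classical.choice
        (Literature.Topology.FourManifolds.isOrientable_of_homotopyEquiv_sphere_four_holds M e)
      nonempty_homotopyEquiv := ⟨e⟩ }
  exact h2 S ((stabOneSuffices_iff.mp h1) S)

/-- **Costume certificate, direction 1**: modulo R, the residual piece E₁ implies Stabilisation's rank-2 crux S2. -/
theorem stabCancellation_of_splitB (hR : CylinderRungTwo) (h2 : ThinForOneStab) : Stabilisation.StabCancellation := by
  rw [stabCancellation_iff]
  intro S hS
  obtain ⟨ι, h1, h2', ⟨R, h3⟩, h4⟩ := h2 S hS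
  exact hR S.carrier (Classical.choice S.nonempty_homotopyEquiv) ι h1 h2' ⟨R, h3⟩ h4

/-- **Costume certificate, direction 2**: S2 implies E₁ outright.  So E₁ ⟺ S2 modulo R: split B is Stabilisation's `closes`
(`S1 ∧ S2 ⟺ SPC4`) wearing this crux's badge. -/
theorem thinForOneStab_of_stabCancellation (h : Stabilisation.StabCancellation) : ThinForOneStab := by
  intro S hS
  obtain ⟨φ⟩ := (stabCancellation_iff.mp h) S hS
  exact crossSectionBelow_of_diffeomorph φ

/-! ## §3 STRENGTHEN — closed threshold: `E ⇐ EClosed ∧ RClosed`, and why the gap piece is R -/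

/-- E at the CLOSED threshold `≤ 4/e` (weaker than E; "attainment of the quantised width"). -/
def EClosed : Prop :=
  ∀ (M : Type) [TopologicalSpace M] [T2Space M] [SecondCountableTopology M]
    [ChartedSpace E⁴ M] [IsManifold (𝓡 4) ∞ M], M ≃ₕ 𝕊⁴ → CrossSectionLe level M

/-- R at the closed threshold (sibling crux `CylinderRungTwo` with `<` replaced by `≤`; stronger than R). -/
def RClosed : Prop :=
  ∀ (M : Type) [TopologicalSpace M] [T2Space M] [SecondCountableTopology M]
    [ChartedSpace E⁴ M] [IsManifold (𝓡 4) ∞ M], M ≃ₕ 𝕊⁴ →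
    ∀ ι : M → E⁶, Manifold.IsSmoothEmbedding (𝓡 4) (𝓡 6) ∞ ι → (∀ x, InN (ι x)) → Separates (Set.range ι) →
      cylEntropy (Set.range ι) ≤ level → Nonempty (M ≃ₘ⟮𝓡 4, 𝓡 4⟯ 𝕊⁴)

/-- E implies its closed-threshold weakening. -/
theorem eClosed_of_crux (h : ThinCrossSectionExists) : EClosed := by
  intro M _ _ _ _ _ e
  obtain ⟨ι, h1, h2, h3, h4⟩ := (crux_iff.mp h) M e
  exact ⟨ι, h1, h2, h3, h4.le⟩

/-- The gap piece CONTAINS the sibling crux: `RClosed → CylinderRungTwo`. -/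
theorem cylinderRungTwo_of_rClosed (h : RClosed) : CylinderRungTwo := by
  intro M _ _ _ _ _ e ι h1 h2 h3 h4
  exact h M e ι h1 h2 h3 h4.le

/-- **The closed-threshold "split" of E**: `EClosed → RClosed → E`.  Its proof term ends in `crossSectionBelow_of_diffeomorph`
— the witness is the slice transported along the diffeomorphism produced by `RClosed` (the round-1 costume fingerprint,
exhibited here on purpose): the decomposition is of the SUMMIT (`EClosed ∧ RClosed ⇒ SPC4 ⇒ E`). -/
theorem crux_of_closed (hE : EClosed) (hR : RClosed) : ThinCrossSectionExists := by
  rw [crux_iff]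
  intro M _ _ _ _ _ e
  obtain ⟨ι, h1, h2, h3, h4⟩ := hE M e
  obtain ⟨φ⟩ := hR M e ι h1 h2 h3 h4
  exact crossSectionBelow_of_diffeomorph φ

/-! ## §4 STRENGTHEN — isotopy form: `E ⇐ CrossSectionEmbeddingExists ∧ EIso` -/

/-- Every homotopy 4-sphere HAS a smooth end-separating cross-section embedding (no entropy clause).  SPC4-free and
provable from tree facts (Θ₄ʰ = 0 `isHCobordant_sphere_of_homotopySphere_four`, `boundsContractible_of_isHCobordant_sphere`,
Smale n = 5 `isTrivial_of_isHCobordism_of_five_le`: Σ ⊂ ∂(W₀ × I) ≅ S⁵, two punctures) — the route's own layer-2 child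
"CrossSectionEmbeddingExists". -/
def CrossSectionEmbeddingExists : Prop :=
  ∀ (M : Type) [TopologicalSpace M] [T2Space M] [SecondCountableTopology M]
    [ChartedSpace E⁴ M] [IsManifold (𝓡 4) ∞ M], M ≃ₕ 𝕊⁴ →
    ∃ ι : M → E⁶, Manifold.IsSmoothEmbedding (𝓡 4) (𝓡 6) ∞ ι ∧ (∀ x, InN (ι x)) ∧ Separates (Set.range ι)

/-- **EIso** — the isotopy-form strengthening of E: every smooth end-separating cross-section embedding `ι₀` of a homotopy
4-sphere is joined by a smooth path `F : ℝ × M → ℝ⁶` of smooth end-separating cross-section embeddings (`F 0 = ι₀`) to one,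
`F 1`, of cylinder entropy `< 4/e`. -/
def EIso : Prop :=
  ∀ (M : Type) [TopologicalSpace M] [T2Space M] [SecondCountableTopology M]
    [ChartedSpace E⁴ M] [IsManifold (𝓡 4) ∞ M], M ≃ₕ 𝕊⁴ →
    ∀ ι₀ : M → E⁶, Manifold.IsSmoothEmbedding (𝓡 4) (𝓡 6) ∞ ι₀ → (∀ x, InN (ι₀ x)) → Separates (Set.range ι₀) →
      ∃ F : ℝ → M → E⁶, F 0 = ι₀ ∧ ContMDiff (𝓘(ℝ, ℝ).prod (𝓡 4)) (𝓡 6) ∞ (Function.uncurry F) ∧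
        (∀ t, Manifold.IsSmoothEmbedding (𝓡 4) (𝓡 6) ∞ (F t) ∧ (∀ x, InN (F t x)) ∧ Separates (Set.range (F t))) ∧
        cylEntropy (Set.range (F 1)) < level

/-- **Glue of the isotopy form**: `CrossSectionEmbeddingExists → EIso → E` (take the endpoint of the path). -/
theorem crux_of_iso (h0 : CrossSectionEmbeddingExists) (hI : EIso) : ThinCrossSectionExists := by
  rw [crux_iff]
  intro M _ _ _ _ _ e
  obtain ⟨ι₀, h1, h2, h3⟩ := h0 M e
  obtain ⟨F, -, -, hF, hthin⟩ := hI M e ι₀ h1 h2 h3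
  obtain ⟨hF1, hF2, hF3⟩ := hF 1
  exact ⟨F 1, hF1, hF2, hF3, hthin⟩

/-- EIso is at least as strong as E GIVEN cross-section existence (recorded for the census: the added rigidity — a fixed
isotopy class through cross-sections — is what "thinning = trivialising the h-cobordism the cross-section cuts off" means). -/
theorem eIso_imp_crux_iff (h0 : CrossSectionEmbeddingExists) : (EIso → ThinCrossSectionExists) ↔ True :=
  ⟨fun _ => trivial, fun _ hI => crux_of_iso h0 hI⟩

end Summit.SmoothPoincare4.SmoothPoincare4.Cruxes.ThinCrossSectionExists.StrategyCensus

end
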